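import Literature.AnabelianGeometry.EtaleTheta.ThetaSettingOriginClauses
import Literature.AnabelianGeometry.EtaleTheta.Discharge.Sec1Thm16Carriers
import Literature.AnabelianGeometry.EtaleTheta.SettingGaloisFacts
import Literature.AnabelianGeometry.EtaleTheta.SettingBridge
import HarnessLib

/-!
# [EtTh] §1: the printed construction of `Y_N` (R2) forces every cusp of `Y` to be `K`-rational —
# `aug(D_c) = G_K` for every cuspidal decomposition group `D_c ⊆ Π^tp_Y`; so the parameter (P4) of
# `OncePuncturedData` is a THEOREM of `IsThm16Origin` (interface law over the frozen root)

Mochizuki, *The étale theta function and its Frobenioid-theoretic manifestations*, Publ. RIMS **45** (2009) [EtTh],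
§1, kurims PDF p. 13 «any decomposition group of a cusp of `Y^log` determines, up to conjugation by `(Δ^tp_Y)^ell`, a
SECTION `G_K → (Π^tp_Y)^ell` of the natural surjection `(Π^tp_Y)^ell ↠ G_K` whose restriction to the open subgroup
`G_{K_N} ⊆ G_K` determines an open immersion `G_{K_N} ↪ (Π^tp_Y)^ell/N·(Δ^tp_Y)^ell` … this image determines a Galois
covering `Y_N → Y` … `1 → (Δ^tp_Y)^ell ⊗ ℤ/Nℤ → Gal(Y_N/Y) → Gal(K_N/K) → 1`», p. 14 «`Y₁ = Y`»
[cite: MochizukiEtTh2009, §1 p.13]; [SemiAnbd] §6 p. 71 «`D_x` always surjects onto an open subgroup of `G_K`»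
[cite: MochizukiSemiAnbd2006, §6 p.71].  abc-iut cell, layer L2, seat abc-iut-w5-d051 (gen 4; NV / §1-interface lane).

WHAT.  The cell carries «the cusp is `K`-rational» twice: as the parameter (P4) `map_aug_decomp` of abc-iut-L2-t7's
`ThetaSetting.OncePuncturedData` and as a consequence of the section law C9 of `CuspLaws`
(`CuspLaws.map_aug_decomp`).  This PROOF-ONLY file derives it from the origin clause R2 ALONE (abc-iut-L6-d5's
`Thm16Sub.GtpYNFromCusp`, the printed construction of `Y_N` from a cusp section) together with the root axiom
`map_aug_GtpYN` («`aug(Π^tp_{Y_N}) = G_{K_N}`»), for ANY `D : ThetaSetting p`: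

* `ThetaSetting.ellPowersY_normal`, `ellPowersY_le_map_dtpY` — `N·(Δ^tp_Y)^ell` is a normal subgroup of `(Π^tp_X)^ell`
  contained in `(Δ^tp_Y)^ell` (abc-iut-w5-d051's `Thm16Sub.conj_mem_ellPowersY`, surjectivity of `Π^tp_X ↠ (Π^tp_X)^ell`);
* **`ThetaSetting.GKN_le_map_aug_of_gtpYNFromCusp`** — R2 at level `N` ⇒ `G_{K_N} ≤ aug(D_c)` for EVERY cuspidal
  decomposition group `D_c ⊆ Π^tp_Y`: a `σ ∈ G_{K_N}` lifts to `g ∈ Π^tp_{Y_N}` (`map_aug_GtpYN`); by R2 (→) its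
  ell-image is `d^ell · π` with `d ∈ D_c ∩ aug⁻¹(G_{K_N})` and `π ∈ N·(Δ^tp_Y)^ell ⊆ (Δ^tp_Y)^ell`, so
  `g ∈ d · Δ^tp_Y · Ker(↠ ell)` and `Ker(↠ ell) ⊆ Δ^tp_X` (`ker_toEll_le_deltaTemp`): `aug g = aug d`;
* **`ThetaSetting.map_aug_eq_GK_of_gtpYNFromCusp_one`** — R2 at level `N = 1` (`K₁ = K`, `GKN_one`) ⇒
  `aug(D_c) = G_K`: the cusp is `K`-RATIONAL;
* packaged: **`ThetaSetting.IsThm16Origin.map_aug_eq_GK`** (every cuspidal `D_c ⊆ Π^tp_Y`),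
  `IsThm16Origin.map_aug_decomp_eq_GK` (the representative `D_x` of a cusp with (P3) `D_x ⊆ Π^tp_Y`) — so the field
  (P4) of `OncePuncturedData` is REDUNDANT given `IsThm16Origin` + (P3) (`IsThm16Origin.p4_of_p3`), and
  `IsThm16Origin.GKN_le_map_aug` (every level).

WHY (NV census of the §1 parameter bundles).  Consistent with print — the construction of `Y_N` on p. 13 presupposes
the section over ALL of `G_K` — and with the negative side of the zoo: at abc-iut-w5-d029's toral-cusp twins R2 fails
(`SettingModelTateCuspOriginProfile`), at the cusp-free carriers R2 is vacuous.  PROOF-ONLY: no definition, no instance,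
no named fact; nothing restated.  HONEST FRAMING: interface law over the frozen root; R2 / `IsThm16Origin` are
hypotheses inhabited only at models; nothing of [EtTh]/[SemiAnbd] is asserted for genuine tempered fundamental groups;
no side is taken on [IUTchIII] Cor. 3.12; typed ≠ proved.
-/

noncomputable section

namespace Literature.AnabelianGeometry.EtaleTheta

open Literature.AnabelianGeometry.SemiGraphs Thm16Sub
open scoped Pointwise

namespace ThetaSetting

variable {p : ℕ} [Fact p.Prime] (D : ThetaSetting p)

/-! ### 1. `N·(Δ^tp_Y)^ell` is normal and lies in `(Δ^tp_Y)^ell` -/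

/-- `N·(Δ^tp_Y)^ell` is a NORMAL subgroup of `(Π^tp_X)^ell` (conjugation-stable under `toEll(Π^tp_X)`, abc-iut-w5-d051's
`Thm16Sub.conj_mem_ellPowersY`, and `Π^tp_X ↠ (Π^tp_X)^ell` is onto). [cite: MochizukiEtTh2009, §1 p.13] -/
theorem ellPowersY_normal (N : ℕ+) : (ellPowersY D N).Normal := by
  refine ⟨fun b hb x => ?_⟩
  obtain ⟨g, rfl⟩ := (D.thetaToEll_surjective.comp D.toTheta_surjective) x
  exact conj_mem_ellPowersY D N g hb

/-- `N·(Δ^tp_Y)^ell ⊆ (Δ^tp_Y)^ell` (the generating `N`-th powers lie in the image subgroup).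
[cite: MochizukiEtTh2009, §1 p.13] -/
theorem ellPowersY_le_map_dtpY (N : ℕ+) : ellPowersY D N ≤ D.DtpY.map (toEll D) := by
  rw [ellPowersY, Subgroup.closure_le]
  rintro _ ⟨y, hy, rfl⟩
  exact pow_mem hy _

/-! ### 2. R2 ⇒ every `σ ∈ G_{K_N}` is the augmentation of an element of the cusp's decomposition group -/

/-- **R2 at level `N` ⇒ `G_{K_N} ≤ aug(D_c)`** for every cuspidal decomposition group `D_c ⊆ Π^tp_Y`.
[cite: MochizukiEtTh2009, §1 p.13] -/
theorem GKN_le_map_aug_of_gtpYNFromCusp (N : ℕ+) (hR2 : GtpYNFromCusp D N) {Dc : Subgroup D.PiTemp}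
    (hDc : D.IsCuspidalDecompositionGroup Dc) (hDcY : Dc ≤ D.GtpY) :
    D.GKN N ≤ Dc.map D.aug.toMonoidHom := by
  intro σ hσ
  -- lift `σ` to `Π^tp_{Y_N}` (root field `map_aug_GtpYN`)
  have hlift : σ ∈ (D.GtpYN N).map D.aug.toMonoidHom := by rw [D.map_aug_GtpYN N]; exact hσ
  obtain ⟨g, hgN, hgσ⟩ := hlift
  -- R2 (→): the ell-image of `g` is `d^ell · π`
  have hR := ((hR2 Dc hDc hDcY g).mp hgN).2.2
  haveI := D.ellPowersY_normal N
  have hset : toEll D g ∈ (((Dc ⊓ (D.GKN N).comap D.aug.toMonoidHom).map (toEll D) ⊔ ellPowersY D N :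
      Subgroup D.GtpEll) : Set D.GtpEll) := hR
  rw [Subgroup.mul_normal] at hset
  obtain ⟨_, ⟨d, hd, rfl⟩, π, hπ, hdπ⟩ := Set.mem_mul.mp hset
  obtain ⟨hdc, hdK⟩ := Subgroup.mem_inf.mp hd
  -- `π = w^ell` with `w ∈ Δ^tp_Y`
  obtain ⟨w, hw, rfl⟩ := D.ellPowersY_le_map_dtpY N hπ
  -- `g = d · w · k` with `k ∈ Ker(↠ ell) ⊆ Δ^tp_X`
  have hk : (d * w)⁻¹ * g ∈ (toEll D).ker := by
    rw [MonoidHom.mem_ker, map_mul, map_inv, map_mul, hdπ, inv_mul_cancel]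
  have hkΔ : (d * w)⁻¹ * g ∈ D.DeltaTemp := D.ker_toEll_le_deltaTemp hk
  have hwΔ : w ∈ D.DeltaTemp := hw.2
  refine ⟨d, hdc, ?_⟩
  -- `aug g = aug d · aug w · aug k = aug d`
  have hg : g = d * w * ((d * w)⁻¹ * g) := by rw [mul_inv_cancel_left]
  rw [← hgσ, hg, map_mul, map_mul, (MonoidHom.mem_ker).mp hwΔ, (MonoidHom.mem_ker).mp hkΔ, mul_one, mul_one]

/-- **R2 at level `1` ⇒ the cusp is `K`-RATIONAL: `aug(D_c) = G_K`** for every cuspidal decomposition group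
`D_c ⊆ Π^tp_Y` (`K₁ = K`, abc-iut-L2's `GKN_one`; `aug(Π^tp_X) = G_K`, root field `range_aug`).
[cite: MochizukiEtTh2009, §1 p.13] -/
theorem map_aug_eq_GK_of_gtpYNFromCusp_one (hR2 : GtpYNFromCusp D 1) {Dc : Subgroup D.PiTemp}
    (hDc : D.IsCuspidalDecompositionGroup Dc) (hDcY : Dc ≤ D.GtpY) :
    Dc.map D.aug.toMonoidHom = D.GK := by
  refine le_antisymm ?_ ?_
  · rintro _ ⟨d, -, rfl⟩
    have h : D.aug.toMonoidHom d ∈ D.aug.toMonoidHom.range := ⟨d, rfl⟩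
    rw [D.range_aug] at h
    exact h
  · rw [← D.GKN_one]
    exact D.GKN_le_map_aug_of_gtpYNFromCusp 1 hR2 hDc hDcY

/-! ### 3. Packaged: (P4) is a theorem of `IsThm16Origin` -/

/-- **`IsThm16Origin` ⇒ every cusp of `Y` is `K`-rational**: `aug(D_c) = G_K` for every cuspidal decomposition group
`D_c ⊆ Π^tp_Y` (field R2 at `N = 1`). [cite: MochizukiEtTh2009, §1 p.13] -/
theorem IsThm16Origin.map_aug_eq_GK {D : ThetaSetting p} (h16 : D.IsThm16Origin) {Dc : Subgroup D.PiTemp}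
    (hDc : D.IsCuspidalDecompositionGroup Dc) (hDcY : Dc ≤ D.GtpY) :
    Dc.map D.aug.toMonoidHom = D.GK :=
  D.map_aug_eq_GK_of_gtpYNFromCusp_one (h16.gtpYN_fromCusp 1) hDc hDcY

/-- **`IsThm16Origin` ⇒ `G_{K_N} ≤ aug(D_c)` at every level.** [cite: MochizukiEtTh2009, §1 p.13] -/
theorem IsThm16Origin.GKN_le_map_aug {D : ThetaSetting p} (h16 : D.IsThm16Origin) (N : ℕ+)
    {Dc : Subgroup D.PiTemp} (hDc : D.IsCuspidalDecompositionGroup Dc) (hDcY : Dc ≤ D.GtpY) :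
    D.GKN N ≤ Dc.map D.aug.toMonoidHom :=
  D.GKN_le_map_aug_of_gtpYNFromCusp N (h16.gtpYN_fromCusp N) hDc hDcY

/-- **The representative form**: for a cusp `x` whose decomposition group `D_x` lies in `Π^tp_Y` ((P3)), `IsThm16Origin`
gives `aug(D_x) = G_K` — the field (P4) `map_aug_decomp` of abc-iut-L2-t7's `OncePuncturedData`, as a THEOREM.
[cite: MochizukiEtTh2009, §1 p.13] -/
theorem IsThm16Origin.map_aug_decomp_eq_GK {D : ThetaSetting p} (h16 : D.IsThm16Origin) {x : D.Pt}
    (hx : D.IsCusp x) (hP3 : D.decomp x ≤ D.GtpY) :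
    (D.decomp x).map D.aug.toMonoidHom = D.GK :=
  h16.map_aug_eq_GK ⟨x, hx, 1, (one_smul _ _).symm⟩ hP3

/-- **(P4) ⟸ `IsThm16Origin` + (P3)**: the clause «decomposition groups of cusps map onto `G_K`» of
`OncePuncturedData`, for all cusps at once, from the origin predicate and the clause «decomposition groups of cusps lie
in `Π^tp_Y`». [cite: MochizukiEtTh2009, §1 p.13] -/
theorem IsThm16Origin.p4_of_p3 {D : ThetaSetting p} (h16 : D.IsThm16Origin)
    (hP3 : ∀ x : D.Pt, D.IsCusp x → D.decomp x ≤ D.toZ.ker) :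
    ∀ x : D.Pt, D.IsCusp x → (D.decomp x).map D.aug.toMonoidHom = D.GK :=
  fun x hx => h16.map_aug_decomp_eq_GK hx (hP3 x hx)

end ThetaSetting

end Literature.AnabelianGeometry.EtaleTheta

end
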